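import Literature.Topology.FourManifolds.HomotopySpheresInverse
import Literature.Topology.FourManifolds.BallRemovalCobordism
import Literature.AlgebraicTopology.Homotopy.ComplBallHomotopyEquiv
import Literature.AlgebraicTopology.Homotopy.CWTypeCompactBoundary
import Literature.AlgebraicTopology.SingularHomology.ContractiblePunctured
import Literature.AlgebraicTopology.FundamentalGroup.SphereSimplyConnected
import HarnessLib

/-!
# Inverses in `Θₙ`: the homotopy theory of Kervaire–Milnor's Lemma 2.3, reduced to Whitehead's theorem and a Poincaré duality step

Topic `Literature/Topology/FourManifolds`, third file of the decomposition of Kervaire–Milnor's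
Lemma 2.3 (*Groups of homotopy spheres I*, Ann. of Math. 77 (1963), p. 506), direction `⇐`:
*a closed simply connected manifold which bounds a contractible manifold is h-cobordant to `Sⁿ`*.
`HomotopySpheresInverse.lean` splits the printed proof into a smooth half (removing an open ball
from `Int W'` gives a cobordism `(W; M, Sⁿ)`; **proved** in `BallRemovalCobordism.lean`) and a
homotopy-theoretic half, the named fact
`Literature.Topology.FourManifolds.NullCobordism.isHomotopyEquiv_compl_ball_of_contractibleSpace`:
for `W'` contractible with simply connected boundary `M`, `n ≥ 2`, both ends `M → K`, `Sⁿ → K` of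
(any model `K` of) the ball complement `W' ∖ i(B̊ⁿ⁺¹)` are homotopy equivalences. The printed
argument for the latter (pp. 506–507) is: `W` is simply connected; "Mapping the homology exact
sequence of the pair `(Dⁿ⁺¹, Sⁿ)` into that of the pair `(W', W)`, we see that the inclusion
`Sⁿ → W` induces a homology isomorphism; hence `Sⁿ` is a deformation retract of `W`" (excision and
Whitehead's theorem); "Now applying the Poincaré duality isomorphism `Hₖ(W, M) ≅ Hⁿ⁺¹⁻ᵏ(W, Sⁿ)`,
we see that the inclusion `M → W` also induces isomorphisms of homology groups. Since `M` is
simply connected, this completes the proof" (Poincaré–Lefschetz duality and Whitehead again).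

This file **proves** that named fact from standard theorems of algebraic topology, all but one
already vendored in the tree as named facts, and proves outright every step of the printed
argument that does not need them:

* **Proved.** The smooth embedding `i : ℝⁿ⁺¹ → Int W'` is an open embedding (equidimensional
  immersion, `isOpen_range_of_isImmersion_of_finrank_le`), hence ball-removal data
  (`BallRemovalData`, `BallRemovalCobordism.lean`), whose glued manifold `D.K` is a compact
  `(n+1)`-manifold with boundary homeomorphic to `W' ∖ i(B̊)` and homotopy equivalent to the
  point complement `W' ∖ {i 0}` (`BallRemovalData.homotopyEquivComplCenter`; radial deformation,
  `ComplBallHomotopyEquiv.lean`). `W' ∖ {i 0}` — hence `D.K` — is simply connected (general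
  position in dimension `n + 1 ≥ 3`, `SimplyConnectedComplPoint.lean`;
  `BallRemovalData.simplyConnectedSpace_K`). The end `Sⁿ → D.K` is a homology isomorphism
  (`BallRemovalData.isIso_singularHomology_map_cobInrCM`), by the Mayer–Vietoris theorem of
  `ContractiblePunctured.lean` (`isIso_singularHomology_map_sphereToComplCenter`: the link of a
  Euclidean point of a contractible space is a homology sphere) — this is the excision step of
  the printed proof.
* **Named facts consumed.** Whitehead's theorem in homology form (Hatcher 2002, Cor. 4.33;
  `whitehead_exists_homotopyEquiv`, `WhiteheadTheorem.lean`) and the CW homotopy type of compact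
  manifolds, closed (Hatcher Cor. A.12; `exists_cwComplex_homotopyEquiv_of_compactSpace`) and with
  boundary (`exists_cwComplex_homotopyEquiv_of_compactSpace_boundary`,
  `CWTypeCompactBoundary.lean`), for the two applications of "homology isomorphism between simply
  connected spaces ⟹ homotopy equivalence"; and the **Poincaré duality step**, vendored here as
  the named fact `NullCobordism.isIso_singularHomology_map_inclToComplCenter` (`M → W' ∖ {i 0}`
  is a homology isomorphism; Kervaire–Milnor p. 507), which is where Lefschetz duality for
  `(W', ∂W')` (tree named facts of `LefschetzDuality.lean`, Spanier 6.3.5 and 6.3.12) enters and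
  whose derivation from those facts is left to a sibling file.
* **Assembled.** `NullCobordism.isHomotopyEquiv_compl_ball_of_contractibleSpace_of_whitehead`:
  the target named fact from the four facts; and Lemma 2.3 (`⇐`) itself from the same four facts
  (`isHCobordant_sphere_of_boundsContractible_of_whitehead`), the smooth half being proved.

No declaration in this file uses `sorry`; the only new named fact is the duality step.

## Design notes

* Everything is in universe `0` (`M : Type`, `c.W : Type`, `𝕊ⁿ : Type`), as the target fact and
  `BallRemovalData.Compl` are; the Whitehead and CW facts are consumed at `.{0}`.
* The point complement is spelled `↥({i 0}ᶜ : Set W')` (as in `SimplyConnectedComplPoint.lean` and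
  `ContractiblePunctured.lean`); `BallRemovalData.complCenterHomeomorph` bridges to the spelling
  `{w // w ≠ i 0}` of `ComplBallHomotopyEquiv.lean`.

## References

* M. Kervaire, J. Milnor, *Groups of homotopy spheres I*, Ann. of Math. (2) 77 (1963), 504–537:
  Lemma 2.3 and its proof (pp. 506–507). doi:10.2307/1970128 [KervaireMilnorAnnals1963]
* A. Hatcher, *Algebraic Topology*, CUP (2002), Cor. 4.33, Appendix Cor. A.12, §2.2
  (Mayer–Vietoris). [HatcherAT2002]
* E. H. Spanier, *Algebraic Topology* (1966; Springer 1981), Ch. 6 §3, Thm. 5, Thm. 12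
  (Lefschetz duality). [Spanier1981]
-/

noncomputable section

open scoped Manifold ContDiff Topology ContinuousMap
open CategoryTheory Set Function Metric Module
open Literature.AlgebraicTopology.SingularHomology Literature.AlgebraicTopology.Homotopy

namespace Literature.Topology.FourManifolds

/-- Local notation: `𝔼 n` is the model Euclidean space `EuclideanSpace ℝ (Fin n)`. -/
local notation "𝔼 " n:arg => EuclideanSpace ℝ (Fin n)

/-- Local notation: `𝕊 n` is the unit sphere in `EuclideanSpace ℝ (Fin (n + 1))`. -/
local notation "𝕊 " n:arg => (Metric.sphere (0 : EuclideanSpace ℝ (Fin (n + 1))) 1)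

/-! ### Homotopy equivalences and homeomorphisms -/

section HomotopyEquiv

variable {X Y Z : Type*} [TopologicalSpace X] [TopologicalSpace Y] [TopologicalSpace Z]

/-- A homotopy equivalence followed by a homeomorphism is a homotopy equivalence. [folklore] -/
theorem IsHomotopyEquiv.homeomorph_comp {f : X → Y} (hf : IsHomotopyEquiv f) (φ : Y ≃ₜ Z) :
    IsHomotopyEquiv (φ ∘ f) := by
  obtain ⟨e, he⟩ := hf
  exact ⟨e.trans φ.toHomotopyEquiv, by rw [← he]; rfl⟩

/-- If `φ ∘ f` is a homotopy equivalence for a homeomorphism `φ`, so is `f`. [folklore] -/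
theorem IsHomotopyEquiv.of_homeomorph_comp {f : X → Y} (φ : Y ≃ₜ Z)
    (h : IsHomotopyEquiv (φ ∘ f)) : IsHomotopyEquiv f := by
  have h' := h.homeomorph_comp φ.symm
  have hf : (φ.symm : Z → Y) ∘ (φ ∘ f) = f := by
    funext x
    exact φ.symm_apply_apply (f x)
  rwa [hf] at h'

end HomotopyEquiv

/-! ### The comparison maps into the point complement `W ∖ {i 0}` -/

namespace BallRemovalData

variable {n : ℕ} {M : Type} [TopologicalSpace M] [ChartedSpace (𝔼 n) M]
  (c : NullCobordism n M) (D : BallRemovalData n c.W)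

/-- The centre of the disc is not a boundary point: `incl x ≠ i 0`. [folklore] -/
theorem incl_ne_center (x : M) : c.incl x ≠ D.i 0 := fun h =>
  D.incl_not_mem_range c x ⟨0, h.symm⟩

/-- **The boundary mapped into the point complement**: `M → W ∖ {i 0}`, `x ↦ incl x`
(Kervaire–Milnor 1963, proof of Lemma 2.3: the inclusion `M → W` of the boundary, `W` being a
deformation retract of `W' ∖ {p}`). [cite: KervaireMilnorAnnals1963, Lemma 2.3, proof (pp. 506–507)] -/
def inclToComplCenter : C(M, ↥(({D.i 0}ᶜ : Set c.W))) where
  toFun x := ⟨c.incl x, D.incl_ne_center c x⟩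
  continuous_toFun := c.continuous_incl.subtype_mk _

/-- The value of `inclToComplCenter`. [folklore] -/
@[simp] theorem coe_inclToComplCenter (x : M) : (D.inclToComplCenter c x : c.W) = c.incl x := rfl

/-- The point complement in the two spellings `{w // w ≠ i 0}` (`ComplBallHomotopyEquiv.lean`)
and `↥({i 0}ᶜ)`. [folklore] -/
def complCenterHomeomorph : ComplBall.ComplCenterT D.i ≃ₜ ↥(({D.i 0}ᶜ : Set c.W)) where
  toFun x := ⟨x.1, x.2⟩
  invFun x := ⟨x.1, x.2⟩
  left_inv _ := rfl
  right_inv _ := rfl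
  continuous_toFun := continuous_subtype_val.subtype_mk _
  continuous_invFun := continuous_subtype_val.subtype_mk _

/-- **The comparison map `K → W ∖ {i 0}`**: the identification `K ≅ W ∖ i(B̊)`
(`BallRemovalData.homeomorph`) followed by the inclusion `W ∖ i(B̊) ↪ W ∖ {i 0}`, a homotopy
equivalence (`ComplBall.homotopyEquiv`, radial deformation retraction). [folklore] -/
def toComplCenter : C(D.K, ↥(({D.i 0}ᶜ : Set c.W))) :=
  ((D.complCenterHomeomorph c : C(_, _)).comp
    (ComplBall.homotopyEquiv D.isOpenEmbedding_i).toFun).comp (D.homeomorph c : C(_, _))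

/-- The value of the comparison map: the underlying point of `W`. [folklore] -/
@[simp] theorem coe_toComplCenter (p : D.K) : (D.toComplCenter c p : c.W) = D.homeomorph c p := rfl

/-- The comparison map induces isomorphisms on all singular homology groups (homeomorphisms and
a homotopy equivalence; Hatcher 2002, Cor. 2.11). [folklore] -/
theorem isIso_singularHomology_map_toComplCenter (k : ℕ) :
    IsIso (singularHomology.map ℤ ℤ (D.toComplCenter c) k) := by
  rw [toComplCenter, singularHomology.map_comp, singularHomology.map_comp,
    ← singularHomology.mapIso_hom, ← singularHomology.mapIso_hom,
    ← singularHomology.isoOfHomotopyEquiv_hom]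
  infer_instance

/-- `K` is homotopy equivalent to the point complement `W ∖ {i 0}`. [folklore] -/
def homotopyEquivComplCenter : D.K ≃ₕ ↥(({D.i 0}ᶜ : Set c.W)) :=
  ((D.homeomorph c).toHomotopyEquiv.trans (ComplBall.homotopyEquiv D.isOpenEmbedding_i)).trans
    (D.complCenterHomeomorph c).toHomotopyEquiv

/-- The incoming end `M → K` of the ball-removal cobordism as a continuous map. [folklore] -/
def cobInlCM [IsManifold (𝓡 n) ∞ M] : C(M, D.K) :=
  ⟨D.cobInl c, (D.isSmoothEmbedding_cobInl c).isEmbedding.continuous⟩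

/-- The outgoing end `𝕊ⁿ → K` of the ball-removal cobordism as a continuous map. [folklore] -/
def cobInrCM : C(𝕊 n, D.K) :=
  ⟨D.cobInr c, (D.isSmoothEmbedding_cobInr c).isEmbedding.continuous⟩

/-- `cobInlCM` is `cobInl` (definitional). [folklore] -/
@[simp] theorem coe_cobInlCM [IsManifold (𝓡 n) ∞ M] : ⇑(D.cobInlCM c) = D.cobInl c := rfl

/-- `cobInrCM` is `cobInr` (definitional). [folklore] -/
@[simp] theorem coe_cobInrCM : ⇑(D.cobInrCM c) = D.cobInr c := rfl

/-- On the incoming end the comparison map is the boundary inclusion. [folklore] -/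
theorem toComplCenter_comp_cobInlCM [IsManifold (𝓡 n) ∞ M] :
    (D.toComplCenter c).comp (D.cobInlCM c) = D.inclToComplCenter c := by
  ext x : 1
  exact Subtype.ext (D.coe_homeomorph_cobInl c x)

/-- On the outgoing end the comparison map is the embedded unit sphere
(`sphereToComplCenter`). [folklore] -/
theorem toComplCenter_comp_cobInrCM :
    (D.toComplCenter c).comp (D.cobInrCM c) =
      sphereToComplCenter D.isOpenEmbedding_i.isEmbedding := by
  ext y : 1
  exact Subtype.ext (D.coe_homeomorph_cobInr c y)

/-! #### Simple connectivity of the ball complement -/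

/-- **The point complement `W ∖ {i 0}` of a contractible `W` is simply connected** (`n + 1 ≥ 3`):
`W` is simply connected and the point has a Euclidean neighbourhood of dimension `n + 1 ≥ 3`
(general position, tree theorem `isSimplyConnected_compl_singleton_of_isOpenEmbedding`;
Kervaire–Milnor 1963, proof of Lemma 2.3: "we obtain a simply connected manifold `W`").
[cite: KervaireMilnorAnnals1963, Lemma 2.3, proof (p. 506)] -/
theorem simplyConnectedSpace_complCenter [ContractibleSpace c.W] (hn : 2 ≤ n) :
    SimplyConnectedSpace ↥(({D.i 0}ᶜ : Set c.W)) := by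
  refine (Literature.AlgebraicTopology.FundamentalGroupoid.isSimplyConnected_compl_singleton_of_isOpenEmbedding
    D.isOpenEmbedding_i ?_).simplyConnectedSpace
  rw [finrank_euclideanSpace_fin]
  omega

/-- **The ball complement `K ≅ W ∖ i(B̊)` of a contractible `W` is simply connected**
(`n + 1 ≥ 3`; it is homotopy equivalent to `W ∖ {i 0}`). [cite: KervaireMilnorAnnals1963, Lemma 2.3, proof (p. 506)] -/
theorem simplyConnectedSpace_K [ContractibleSpace c.W] (hn : 2 ≤ n) : SimplyConnectedSpace D.K :=
  haveI := D.simplyConnectedSpace_complCenter c hn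
  (D.homotopyEquivComplCenter c).simplyConnectedSpace

/-! #### Homology of the two ends, transported to `K` -/

/-- The outgoing end `𝕊ⁿ → K` induces isomorphisms on all `Hₖ(-; ℤ)` when `W` is contractible
(`n ≥ 1`): transport of `isIso_singularHomology_map_sphereToComplCenter` (Mayer–Vietoris for
`W = (W ∖ {i 0}) ∪ i(ℝⁿ⁺¹)`) along `K ≃ W ∖ {i 0}`. Kervaire–Milnor 1963, proof of Lemma 2.3: "the
inclusion `Sⁿ → W` induces a homology isomorphism". [cite: KervaireMilnorAnnals1963, Lemma 2.3, proof (p. 506)] -/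
theorem isIso_singularHomology_map_cobInrCM [ContractibleSpace c.W] (hn : 1 ≤ n) (k : ℕ) :
    IsIso (singularHomology.map ℤ ℤ (D.cobInrCM c) k) := by
  haveI := D.isIso_singularHomology_map_toComplCenter c k
  haveI : IsIso (singularHomology.map ℤ ℤ (D.cobInrCM c) k ≫
      singularHomology.map ℤ ℤ (D.toComplCenter c) k) := by
    rw [← singularHomology.map_comp, D.toComplCenter_comp_cobInrCM c]
    exact isIso_singularHomology_map_sphereToComplCenter ℤ ℤ D.isOpenEmbedding_i hn k
  exact IsIso.of_isIso_comp_right _ (singularHomology.map ℤ ℤ (D.toComplCenter c) k)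

/-- The incoming end `M → K` induces isomorphisms on all `Hₖ(-; ℤ)` as soon as
`M → W ∖ {i 0}` does (transport along `K ≃ W ∖ {i 0}`). [folklore] -/
theorem isIso_singularHomology_map_cobInlCM [IsManifold (𝓡 n) ∞ M]
    (h : ∀ k : ℕ, IsIso (singularHomology.map ℤ ℤ (D.inclToComplCenter c) k)) (k : ℕ) :
    IsIso (singularHomology.map ℤ ℤ (D.cobInlCM c) k) := by
  haveI := D.isIso_singularHomology_map_toComplCenter c k
  haveI : IsIso (singularHomology.map ℤ ℤ (D.cobInlCM c) k ≫
      singularHomology.map ℤ ℤ (D.toComplCenter c) k) := by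
    rw [← singularHomology.map_comp, D.toComplCenter_comp_cobInlCM c]
    exact h k
  exact IsIso.of_isIso_comp_right _ (singularHomology.map ℤ ℤ (D.toComplCenter c) k)

end BallRemovalData

/-! ### Named fact: the Poincaré duality step of Lemma 2.3 -/

/-- **The boundary of a contractible bounding manifold includes into the point complement by a
homology isomorphism** (the Poincaré duality step in Kervaire–Milnor, *Groups of homotopy
spheres I* (1963), proof of Lemma 2.3, pp. 506–507: "Now applying the Poincaré duality
isomorphism `Hₖ(W, M) ≅ Hⁿ⁺¹⁻ᵏ(W, Sⁿ)`, we see that the inclusion `M → W` also induces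
isomorphisms of homology groups"). Precisely: for a null-cobordism `M = ∂W'` (tree structure
`NullCobordism`) of a closed simply connected smooth `n`-manifold `M`, `n ≥ 2`, with `W'`
contractible, and ball-removal data `i : ℝⁿ⁺¹ → Int W'` (tree structure `BallRemovalData`: a
smooth open disc in the interior), the map `x ↦ incl x : M → W' ∖ {i 0}`
(`BallRemovalData.inclToComplCenter`) induces isomorphisms on `Hₖ(-; ℤ)` for all `k` — the
printed `W = W' - Int Dⁿ⁺¹` being a deformation retract of `W' ∖ {i 0}`
(`ComplBall.homotopyEquiv`). In the tree this follows from Lefschetz duality for `(W', ∂W')`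
(named facts `relativeSingularHomology.exists_linearEquiv_of_ne_zero`,
`bijective_relCapProduct_of_isRelFundamentalClass` of `LefschetzDuality.lean`, Spanier 1966,
6.3.5 and 6.3.12) together with the long exact sequences of the pairs `(W', ∂W')`, `(W', W' ∖ p)`;
it is vendored here as a named fact pending that derivation. [cite: KervaireMilnorAnnals1963, Lemma 2.3, proof (pp. 506–507)] -/
def NullCobordism.isIso_singularHomology_map_inclToComplCenter : Prop :=
  ∀ (n : ℕ) (M : Type) [TopologicalSpace M] [T2Space M] [SecondCountableTopology M]
    [ChartedSpace (𝔼 n) M] [IsManifold (𝓡 n) ∞ M] [CompactSpace M] [SimplyConnectedSpace M]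
    (c : NullCobordism n M), 2 ≤ n → ContractibleSpace c.W →
    ∀ (D : BallRemovalData n c.W) (k : ℕ),
      IsIso (singularHomology.map ℤ ℤ (D.inclToComplCenter c) k)

/-! ### The ball-removal cobordism of a contractible null-cobordism is an h-cobordism -/

namespace BallRemovalData

variable {n : ℕ} {M : Type} [TopologicalSpace M] [T2Space M] [SecondCountableTopology M]
  [ChartedSpace (𝔼 n) M] [IsManifold (𝓡 n) ∞ M] [CompactSpace M] [SimplyConnectedSpace M]
  (c : NullCobordism n M) (D : BallRemovalData n c.W)

omit [T2Space M] [SecondCountableTopology M] [IsManifold (𝓡 n) ∞ M] [CompactSpace M]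
  [SimplyConnectedSpace M] in
/-- **The outgoing end `𝕊ⁿ → K` is a homotopy equivalence** for `W` contractible, `n ≥ 2`,
GIVEN Whitehead's theorem (`whitehead_exists_homotopyEquiv`, Hatcher Cor. 4.33) and the CW
homotopy type of compact manifolds (`exists_cwComplex_homotopyEquiv_of_compactSpace`,
`…_boundary`, Hatcher Cor. A.12): `𝕊ⁿ` and `K` are simply connected and `𝕊ⁿ → K` is a homology
isomorphism (`isIso_singularHomology_map_cobInrCM`, proved). Kervaire–Milnor 1963, proof of
Lemma 2.3: "hence `Sⁿ` is a deformation retract of `W`".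
[cite: KervaireMilnorAnnals1963, Lemma 2.3, proof (p. 506)] -/
theorem isHomotopyEquiv_cobInr_of_whitehead (hW : whitehead_exists_homotopyEquiv.{0})
    (hCW : exists_cwComplex_homotopyEquiv_of_compactSpace.{0})
    (hCW' : exists_cwComplex_homotopyEquiv_of_compactSpace_boundary.{0})
    [ContractibleSpace c.W] (hn : 2 ≤ n) : IsHomotopyEquiv (D.cobInr c) := by
  haveI := D.simplyConnectedSpace_K c hn
  haveI := Literature.AlgebraicTopology.FundamentalGroup.simplyConnectedSpace_euclideanSphere n hn
  obtain ⟨e, he⟩ := exists_homotopyEquiv_of_isIso_map_of_compactManifoldBoundary (m := n) (k := n)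
    hW hCW hCW' (D.cobInrCM c) (D.isIso_singularHomology_map_cobInrCM c (by omega))
  exact ⟨e, he⟩

/-- **The incoming end `M → K` is a homotopy equivalence** for `W` contractible and `M` simply
connected, `n ≥ 2`, GIVEN Whitehead's theorem, the CW homotopy type of compact manifolds
(Hatcher Cor. 4.33, Cor. A.12) and the Poincaré duality step
(`NullCobordism.isIso_singularHomology_map_inclToComplCenter`). Kervaire–Milnor 1963, proof of
Lemma 2.3: "the inclusion `M → W` also induces isomorphisms of homology groups. Since `M` is
simply connected, this completes the proof". [cite: KervaireMilnorAnnals1963, Lemma 2.3, proof (pp. 506–507)] -/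
theorem isHomotopyEquiv_cobInl_of_whitehead (hW : whitehead_exists_homotopyEquiv.{0})
    (hCW : exists_cwComplex_homotopyEquiv_of_compactSpace.{0})
    (hCW' : exists_cwComplex_homotopyEquiv_of_compactSpace_boundary.{0})
    (hPD : NullCobordism.isIso_singularHomology_map_inclToComplCenter)
    [ContractibleSpace c.W] (hn : 2 ≤ n) : IsHomotopyEquiv (D.cobInl c) := by
  haveI := D.simplyConnectedSpace_K c hn
  obtain ⟨e, he⟩ := exists_homotopyEquiv_of_isIso_map_of_compactManifoldBoundary (m := n) (k := n)
    hW hCW hCW' (D.cobInlCM c)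
    (D.isIso_singularHomology_map_cobInlCM c (hPD n M c hn inferInstance D))
  exact ⟨e, he⟩

/-- **The ball-removal cobordism `(K; M, 𝕊ⁿ)` of a contractible null-cobordism with simply
connected boundary is an h-cobordism** (`n ≥ 2`), GIVEN Whitehead's theorem, the CW homotopy type
of compact manifolds and the Poincaré duality step (Kervaire–Milnor 1963, proof of Lemma 2.3,
pp. 506–507). [cite: KervaireMilnorAnnals1963, Lemma 2.3, proof (pp. 506–507)] -/
theorem isHCobordism_cobordism_of_whitehead (hW : whitehead_exists_homotopyEquiv.{0})
    (hCW : exists_cwComplex_homotopyEquiv_of_compactSpace.{0})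
    (hCW' : exists_cwComplex_homotopyEquiv_of_compactSpace_boundary.{0})
    (hPD : NullCobordism.isIso_singularHomology_map_inclToComplCenter)
    [ContractibleSpace c.W] (hn : 2 ≤ n) :
    IsHomotopyEquiv (D.cobordism c).inl ∧ IsHomotopyEquiv (D.cobordism c).inr :=
  ⟨D.isHomotopyEquiv_cobInl_of_whitehead c hW hCW hCW' hPD hn,
    D.isHomotopyEquiv_cobInr_of_whitehead c hW hCW hCW' hn⟩

end BallRemovalData

/-! ### Assembly: the homotopy-theoretic half of Lemma 2.3 from the standard facts -/

namespace NullCobordism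

/-- **The homotopy theory in Kervaire–Milnor's Lemma 2.3 from Whitehead, the CW type of compact
manifolds, and the Poincaré duality step.** The named fact
`NullCobordism.isHomotopyEquiv_compl_ball_of_contractibleSpace` (`HomotopySpheresInverse.lean`:
for `M = ∂W'` closed simply connected, `n ≥ 2`, `W'` contractible, `i : ℝⁿ⁺¹ → Int W'` a smooth
embedding and `K ≅ W' ∖ i(B̊ⁿ⁺¹)` any model of the ball complement, both `M → K` and `𝕊ⁿ → K` are
homotopy equivalences) follows from: Whitehead's theorem (`whitehead_exists_homotopyEquiv`,
Hatcher 2002, Cor. 4.33), the CW homotopy type of compact manifolds without and with boundary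
(`exists_cwComplex_homotopyEquiv_of_compactSpace`, `…_boundary`, Hatcher Cor. A.12), and the
Poincaré duality step `isIso_singularHomology_map_inclToComplCenter` (Kervaire–Milnor p. 507).
Proof: the smooth embedding `i` has open range (equidimensional immersion,
`isOpen_range_of_isImmersion_of_finrank_le`), so it is ball-removal data `D`; `K` is homeomorphic
to `W' ∖ i(B̊) ≅ D.K` compatibly with the two ends (`BallRemovalData.homeomorph`), and the ends of
`D.K` are homotopy equivalences (`isHCobordism_cobordism_of_whitehead`: simple connectivity of
`W' ∖ {i 0}` by general position, `𝕊ⁿ → W' ∖ {i 0}` a homology isomorphism by Mayer–Vietoris,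
`M → W' ∖ {i 0}` by the duality step, then Whitehead). [cite: KervaireMilnorAnnals1963, Lemma 2.3, proof (pp. 506–507)] -/
theorem isHomotopyEquiv_compl_ball_of_contractibleSpace_of_whitehead
    (hW : whitehead_exists_homotopyEquiv.{0})
    (hCW : exists_cwComplex_homotopyEquiv_of_compactSpace.{0})
    (hCW' : exists_cwComplex_homotopyEquiv_of_compactSpace_boundary.{0})
    (hPD : NullCobordism.isIso_singularHomology_map_inclToComplCenter) :
    NullCobordism.isHomotopyEquiv_compl_ball_of_contractibleSpace := by
  intro n M _ _ _ _ _ _ _ c hn hc i hi hri K _ e he hre f g hf hg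
  haveI := hc
  -- the disc is ball-removal data
  let D : BallRemovalData n c.W :=
    ⟨i, hi, isOpen_range_of_isImmersion_of_finrank_le hi.isImmersion le_rfl, hri⟩
  -- `K ≅ W' ∖ i(B̊)` through `e`
  let ê : K ≃ₜ D.Compl c := he.toHomeomorph.trans (Homeomorph.setCongr hre)
  have hê : ∀ x : K, (ê x : c.W) = e x := fun x => rfl
  -- the two ends of `D.K`, read in `K`
  have hends := D.isHCobordism_cobordism_of_whitehead c hW hCW hCW' hPD hn
  have hf' : (ê.symm ∘ D.homeomorph c) ∘ D.cobInl c = f := by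
    funext x
    apply ê.injective
    rw [Function.comp_apply, Function.comp_apply, ê.apply_symm_apply]
    apply Subtype.ext
    rw [hê, D.coe_homeomorph_cobInl c x]
    exact (congrFun hf x).symm
  have hg' : (ê.symm ∘ D.homeomorph c) ∘ D.cobInr c = g := by
    funext y
    apply ê.injective
    rw [Function.comp_apply, Function.comp_apply, ê.apply_symm_apply]
    apply Subtype.ext
    rw [hê, D.coe_homeomorph_cobInr c y]
    exact (congrFun hg y).symm
  refine ⟨?_, ?_⟩
  · rw [← hf']
    exact hends.1.homeomorph_comp ((D.homeomorph c).trans ê.symm)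
  · rw [← hg']
    exact hends.2.homeomorph_comp ((D.homeomorph c).trans ê.symm)

end NullCobordism

/-! ### Consequences for Lemma 2.3 and the inverses in `Θₙ` -/

/-- **Kervaire–Milnor's Lemma 2.3 (`⇐`) from Whitehead, the CW type of compact manifolds and the
Poincaré duality step**: a closed simply connected smooth `n`-manifold, `n ≥ 2`, bounding a
contractible manifold is h-cobordant to `𝕊ⁿ` — the smooth half of the printed proof being the
tree theorem `NullCobordism.exists_cobordism_sphere_homeomorph_compl_ball`
(`BallRemovalCobordism.lean`) and the homotopy half
`NullCobordism.isHomotopyEquiv_compl_ball_of_contractibleSpace_of_whitehead`.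
[cite: KervaireMilnorAnnals1963, Lemma 2.3 (p. 506), direction ⇐] -/
theorem isHCobordant_sphere_of_boundsContractible_of_whitehead
    (hW : whitehead_exists_homotopyEquiv.{0})
    (hCW : exists_cwComplex_homotopyEquiv_of_compactSpace.{0})
    (hCW' : exists_cwComplex_homotopyEquiv_of_compactSpace_boundary.{0})
    (hPD : NullCobordism.isIso_singularHomology_map_inclToComplCenter) :
    isHCobordant_sphere_of_boundsContractible :=
  isHCobordant_sphere_of_boundsContractible_of
    (fun n M _ _ _ _ _ _ _ c => NullCobordism.exists_cobordism_sphere_homeomorph_compl_ball n M c)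
    (NullCobordism.isHomotopyEquiv_compl_ball_of_contractibleSpace_of_whitehead hW hCW hCW' hPD)

end Literature.Topology.FourManifolds

end
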